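import Literature.Analysis.FunctionSpaces.TorusTrigPoly
import Literature.Analysis.FunctionSpaces.TorusInverseLaplacianL2
import Literature.Analysis.FunctionSpaces.TorusFourierSeries
import HarnessLib

/-!
# `Ḣ⁻¹(𝕋ᵈ)` bounds for derivatives: `‖∂ⱼA‖_{Ḣ⁻¹} ≤ 2π‖A‖_{L²}`, support–`L²` bookkeeping, lower semicontinuity

Analysis/FunctionSpaces support file (theorems only; no named facts). The three elementary facts about the spectral
seminorm `Torus.eHomSobolevSeminorm (-1)` (weight `|k|⁻²` off the zero mode) of complexified real vector fields on
`𝕋ᵈ` that turn the SUPPORT decay of a multiscale construction into the `Ḣ⁻¹`-continuity of its datum (the use in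
Coiculescu–Palasek 2025, §5: "`u ∈ C_w([0,1]; Ḣ⁻¹)` … `U⁰ ∈ Ḣ⁻¹`", realised here for fields `v = ∑_k v_k` whose
level-`k` pieces are derivatives `∂ⱼA` of fields `A` that are `O(1)` in `L^∞` on supports of measure `θ^k`):

* **`eHomSobolevSeminorm_neg_one_partialDeriv_le`**: for a smooth real vector field `A : 𝕋ᵈ → ℝᵈ`,
  `‖∂ⱼA‖_{Ḣ⁻¹} ≤ 2π (∫‖A‖²)^{1/2}` (Fourier side: `𝓕(∂ⱼA)(k) = 2πikⱼÂ(k)`, `kⱼ² ≤ |k|²`, Parseval);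
  `…_smul_const_le`: the same for `x ↦ (∂ⱼg)(x) • e`;
* `integral_norm_sq_le_mul_measureReal`: `∫‖A‖² ≤ B² |S|` if `‖A‖ ≤ B` and `A = 0` off the measurable `S`;
* **`eHomSobolevSeminorm_le_liminf_of_tendstoUniformly`**: the seminorm is lower semicontinuous under uniform
  convergence of continuous functions (Fatou on the Fourier side).

## Mathlib / tree search

Tree: `Torus.mFourierCoeff_complexify_partialDeriv` (`TorusTrigPoly`), `Torus.hasSum_sq_norm_mFourierCoeff_complexify`
(`TorusVectorParseval`), `Torus.one_le_freqNormSq_of_ne_zero`, `Torus.partialDeriv_smul_const`/`partialDeriv_clm_comp`.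
Mathlib: `MeasureTheory.lintegral_liminf_le` + `lintegral_count` (Fatou for series), `Monotone.map_liminf_of_continuousAt`.

## References

* M. P. Coiculescu, S. Palasek, Invent. Math. 244 (2025), arXiv:2503.14699: §5 (proof of Thm. 1.2). [CoiculescuPalasek2025]
* H. Bahouri, J.-Y. Chemin, R. Danchin, *Fourier Analysis and Nonlinear PDE*, Springer 2011: §1.4 (homogeneous Sobolev
  norms on the torus via Fourier series). [BahouriCheminDanchin2011]
* L. Grafakos, *Classical Fourier Analysis*, 3rd ed. (2014): Prop. 3.2.6 (8), Prop. 3.2.7 (3). [Grafakos2014]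
-/

noncomputable section

open MeasureTheory Set Filter Function UnitAddTorus
open scoped ENNReal NNReal Topology ContDiff

namespace Literature.Analysis.FunctionSpaces

namespace Torus

variable {d : Type*} [Fintype d] [DecidableEq d]

/-! ## `‖∂ⱼA‖_{Ḣ⁻¹} ≤ 2π‖A‖_{L²}` -/

/-- The weight–coefficient product of `∂ⱼA` at a frequency is at most `4π²‖Â(k)‖²`. [folklore] -/
theorem weight_mul_enorm_sq_partialDeriv_le {A : UnitAddTorus d → EuclideanSpace ℝ d} (hA : IsSmooth A) (j : d) (k : d → ℤ) :
    (if k = 0 then 0 else ENNReal.ofReal (freqNormSq k ^ (-1 : ℝ))) *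
        ‖mFourierCoeff (EuclideanSpace.complexify ∘ partialDeriv j A) k‖ₑ ^ 2 ≤
      ENNReal.ofReal (4 * Real.pi ^ 2) * ‖mFourierCoeff (EuclideanSpace.complexify ∘ A) k‖ₑ ^ 2 := by
  by_cases hk : k = 0
  · subst hk; simp
  rw [if_neg hk, mFourierCoeff_complexify_partialDeriv hA j k, enorm_smul, mul_pow]
  have hfq : 1 ≤ freqNormSq k := one_le_freqNormSq_of_ne_zero hk
  have hfq0 : 0 < freqNormSq k := lt_of_lt_of_le one_pos hfq
  -- `‖2πi kⱼ‖² |k|⁻² ≤ 4π²`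
  have hcoef : ‖(2 * Real.pi * Complex.I * (k j : ℂ))‖ₑ ^ 2 = ENNReal.ofReal ((2 * Real.pi) ^ 2 * ((k j : ℝ)) ^ 2) := by
    rw [← ofReal_norm, ← ENNReal.ofReal_pow (norm_nonneg _)]
    congr 1
    rw [show (2 * Real.pi * Complex.I * (k j : ℂ)) = ((2 * Real.pi * (k j : ℝ) : ℝ) : ℂ) * Complex.I by push_cast; ring,
      norm_mul, Complex.norm_I, mul_one, Complex.norm_real, Real.norm_eq_abs]
    rw [sq_abs]; ring
  rw [hcoef, ← mul_assoc, ← ENNReal.ofReal_mul (Real.rpow_nonneg hfq0.le _)]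
  gcongr ?_ * _
  refine ENNReal.ofReal_le_ofReal ?_
  have hkj : ((k j : ℝ)) ^ 2 ≤ freqNormSq k := by
    unfold freqNormSq
    exact Finset.single_le_sum (f := fun i => ((k i : ℝ)) ^ 2) (fun i _ => sq_nonneg _) (Finset.mem_univ j)
  rw [Real.rpow_neg_one]
  calc (freqNormSq k)⁻¹ * ((2 * Real.pi) ^ 2 * ((k j : ℝ)) ^ 2) = (2 * Real.pi) ^ 2 * (((k j : ℝ)) ^ 2 / freqNormSq k) := by
        field_simp
    _ ≤ (2 * Real.pi) ^ 2 * 1 := by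
        refine mul_le_mul_of_nonneg_left ((div_le_one hfq0).2 hkj) (by positivity)
    _ = 4 * Real.pi ^ 2 := by ring

omit [DecidableEq d] in
/-- **Parseval in `ℝ≥0∞`, Bochner form** for a continuous real vector field: `∑ₖ ‖Â(k)‖ₑ² = ofReal (∫‖A‖²)`. [cite: Grafakos2014, Prop. 3.2.7 (3)] -/
theorem tsum_enorm_sq_mFourierCoeff_complexify_eq_ofReal {A : UnitAddTorus d → EuclideanSpace ℝ d} (hA : Continuous A) :
    ∑' k, ‖mFourierCoeff (EuclideanSpace.complexify ∘ A) k‖ₑ ^ 2 = ENNReal.ofReal (∫ x, ‖A x‖ ^ 2) := by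
  have hmem : MemLp A 2 volume := hA.memLp_of_hasCompactSupport (HasCompactSupport.of_compactSpace _)
  have hP := hasSum_sq_norm_mFourierCoeff_complexify hmem
  rw [← hP.tsum_eq, ENNReal.ofReal_tsum_of_nonneg (fun k => sq_nonneg _) hP.summable]
  refine tsum_congr fun k => ?_
  rw [← ofReal_norm, ENNReal.ofReal_pow (norm_nonneg _)]

/-- **`‖∂ⱼA‖_{Ḣ⁻¹(𝕋ᵈ)} ≤ 2π ‖A‖_{L²}`** for a smooth real vector field `A` (complexified): on the Fourier side
`𝓕(∂ⱼA)(k) = 2πikⱼÂ(k)` and `kⱼ²/|k|² ≤ 1`, then Parseval. [cite: BahouriCheminDanchin2011, §1.4] -/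
theorem eHomSobolevSeminorm_neg_one_partialDeriv_le {A : UnitAddTorus d → EuclideanSpace ℝ d} (hA : IsSmooth A) (j : d) :
    eHomSobolevSeminorm (-1) (EuclideanSpace.complexify ∘ partialDeriv j A) ≤
      ENNReal.ofReal (2 * Real.pi * (∫ x, ‖A x‖ ^ 2) ^ (1 / 2 : ℝ)) := by
  unfold eHomSobolevSeminorm
  have hle : ∑' k : d → ℤ, (if k = 0 then 0 else ENNReal.ofReal (freqNormSq k ^ (-1 : ℝ))) *
        ‖mFourierCoeff (EuclideanSpace.complexify ∘ partialDeriv j A) k‖ₑ ^ 2 ≤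
      ENNReal.ofReal (4 * Real.pi ^ 2) * ENNReal.ofReal (∫ x, ‖A x‖ ^ 2) := by
    rw [← tsum_enorm_sq_mFourierCoeff_complexify_eq_ofReal hA.continuous, ← ENNReal.tsum_mul_left]
    exact ENNReal.tsum_le_tsum fun k => weight_mul_enorm_sq_partialDeriv_le hA j k
  refine (ENNReal.rpow_le_rpow hle (by norm_num)).trans (le_of_eq ?_)
  have hI : 0 ≤ ∫ x, ‖A x‖ ^ 2 := integral_nonneg fun x => sq_nonneg _
  rw [← ENNReal.ofReal_mul (by positivity), ENNReal.ofReal_rpow_of_nonneg (by positivity) (by norm_num)]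
  congr 1
  rw [Real.mul_rpow (by positivity) hI, show (4 * Real.pi ^ 2 : ℝ) = (2 * Real.pi) ^ 2 by ring, ← Real.sqrt_eq_rpow,
    Real.sqrt_sq (by positivity)]

/-- **`‖(∂ⱼg) e‖_{Ḣ⁻¹(𝕋ᵈ)} ≤ 2π ‖e‖ ‖g‖_{L²}`** for a smooth real scalar `g` and a fixed vector `e`. [cite: BahouriCheminDanchin2011, §1.4] -/
theorem eHomSobolevSeminorm_neg_one_partialDeriv_smul_const_le {g : UnitAddTorus d → ℝ} (hg : IsSmooth g) (j : d) (e : EuclideanSpace ℝ d) :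
    eHomSobolevSeminorm (-1) (EuclideanSpace.complexify ∘ fun x => partialDeriv j g x • e) ≤
      ENNReal.ofReal (2 * Real.pi * ‖e‖ * (∫ x, g x ^ 2) ^ (1 / 2 : ℝ)) := by
  have hA : IsSmooth (fun x => g x • e) := ContDiff.smul hg contDiff_const
  have hderiv : (fun x => partialDeriv j g x • e) = partialDeriv j fun x => g x • e := by
    funext x
    have hc : IsContDiff 1 (fun _ : UnitAddTorus d => e) := (isSmooth_const e).isContDiff (by simp)
    rw [partialDeriv_smul (hg.isContDiff (by simp)) hc j x]
    have h0 : partialDeriv j (fun _ : UnitAddTorus d => e) x = 0 := by simp [partialDeriv, Torus.lineDeriv]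
    rw [h0, smul_zero, zero_add]
  rw [hderiv]
  refine (eHomSobolevSeminorm_neg_one_partialDeriv_le hA j).trans (le_of_eq ?_)
  congr 1
  have hI : ∫ x, ‖g x • e‖ ^ 2 = ‖e‖ ^ 2 * ∫ x, g x ^ 2 := by
    rw [← integral_const_mul]
    refine integral_congr_ae (Eventually.of_forall fun x => ?_)
    show ‖g x • e‖ ^ 2 = ‖e‖ ^ 2 * g x ^ 2
    rw [norm_smul, mul_pow, Real.norm_eq_abs, sq_abs]; ring
  rw [hI, Real.mul_rpow (sq_nonneg _) (integral_nonneg fun x => sq_nonneg _), ← Real.sqrt_eq_rpow (‖e‖ ^ 2), Real.sqrt_sq (norm_nonneg _)]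
  ring

/-! ## `L²` from `L^∞` and the support -/

omit [DecidableEq d] in
/-- **`∫‖A‖² ≤ B² |S|`** if `‖A‖ ≤ B` everywhere and `A` vanishes off the measurable set `S`. [folklore] -/
theorem integral_norm_sq_le_mul_measureReal {E : Type*} [NormedAddCommGroup E] {A : UnitAddTorus d → E} {B : ℝ} {S : Set (UnitAddTorus d)}
    (hS : MeasurableSet S) (hB : ∀ x, ‖A x‖ ≤ B) (hoff : ∀ x, x ∉ S → A x = 0) :
    ∫ x, ‖A x‖ ^ 2 ≤ B ^ 2 * volume.real S := by
  have hB0 : 0 ≤ B := (norm_nonneg _).trans (hB (Classical.arbitrary _))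
  have hpt : ∀ x, ‖A x‖ ^ 2 ≤ S.indicator (fun _ => B ^ 2) x := by
    intro x
    by_cases hx : x ∈ S
    · rw [indicator_of_mem hx]
      exact pow_le_pow_left₀ (norm_nonneg _) (hB x) 2
    · rw [indicator_of_notMem hx, hoff x hx, norm_zero]; simp
  have hint : Integrable (S.indicator fun _ => B ^ 2) volume := (integrable_const _).indicator hS
  calc ∫ x, ‖A x‖ ^ 2 ≤ ∫ x, S.indicator (fun _ => B ^ 2) x :=
        integral_mono_of_nonneg (Eventually.of_forall fun x => sq_nonneg _) hint (Eventually.of_forall hpt)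
    _ = B ^ 2 * volume.real S := by rw [integral_indicator_const _ hS, smul_eq_mul, mul_comm]

/-! ## Lower semicontinuity of the seminorm under uniform convergence -/

omit [DecidableEq d] in
/-- Fourier coefficients depend continuously on the function in the uniform topology:
`‖𝓕f(k) - 𝓕g(k)‖ ≤ sup‖f - g‖`. [folklore] -/
theorem norm_mFourierCoeff_sub_le {E : Type*} [NormedAddCommGroup E] [NormedSpace ℂ E] [CompleteSpace E]
    {f g : UnitAddTorus d → E} (hf : Continuous f) (hg : Continuous g) {B : ℝ} (hB : ∀ x, ‖f x - g x‖ ≤ B) (k : d → ℤ) :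
    ‖mFourierCoeff f k - mFourierCoeff g k‖ ≤ B := by
  have hfi : Integrable f volume := hf.integrable_of_hasCompactSupport (HasCompactSupport.of_compactSpace _)
  have hgi : Integrable g volume := hg.integrable_of_hasCompactSupport (HasCompactSupport.of_compactSpace _)
  rw [← mFourierCoeff_sub hfi hgi]
  exact norm_mFourierCoeff_le_of_forall_norm_le (fun x => hB x) k

omit [DecidableEq d] in
/-- **Lower semicontinuity**: if continuous `fₙ → f` uniformly on `𝕋ᵈ` then `‖f‖_{Ḣˢ} ≤ liminfₙ ‖fₙ‖_{Ḣˢ}` (each Fourier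
coefficient converges; Fatou for the weighted series). [folklore] -/
theorem eHomSobolevSeminorm_le_liminf_of_tendstoUniformly {E : Type*} [NormedAddCommGroup E] [NormedSpace ℂ E] [CompleteSpace E]
    (s : ℝ) {f : UnitAddTorus d → E} {F : ℕ → UnitAddTorus d → E} (hf : Continuous f) (hF : ∀ n, Continuous (F n))
    (hU : TendstoUniformly F f atTop) :
    eHomSobolevSeminorm s f ≤ liminf (fun n => eHomSobolevSeminorm s (F n)) atTop := by
  classical
  unfold eHomSobolevSeminorm
  -- each weighted term converges
  set w : (d → ℤ) → ℝ≥0∞ := fun k => if k = 0 then 0 else ENNReal.ofReal (freqNormSq k ^ s) with hw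
  have hcoef : ∀ k, Tendsto (fun n => mFourierCoeff (F n) k) atTop (𝓝 (mFourierCoeff f k)) := by
    intro k
    rw [tendsto_iff_norm_sub_tendsto_zero]
    have hsup : ∀ ε > 0, ∀ᶠ n in atTop, ‖mFourierCoeff (F n) k - mFourierCoeff f k‖ ≤ ε := by
      intro ε hε
      have := (Metric.tendstoUniformly_iff.1 hU) ε hε
      refine this.mono fun n hn => norm_mFourierCoeff_sub_le (hF n) hf (fun x => ?_) k
      have := hn x
      rw [dist_eq_norm, norm_sub_rev] at this
      exact this.le
    rw [Metric.tendsto_nhds]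
    intro ε hε
    refine (hsup (ε / 2) (half_pos hε)).mono fun n hn => ?_
    rw [dist_zero_right, Real.norm_eq_abs, abs_of_nonneg (norm_nonneg _)]
    linarith
  have hterm : ∀ k, Tendsto (fun n => w k * ‖mFourierCoeff (F n) k‖ₑ ^ 2) atTop (𝓝 (w k * ‖mFourierCoeff f k‖ₑ ^ 2)) := by
    intro k
    have h1 : Tendsto (fun n => ‖mFourierCoeff (F n) k‖ₑ ^ 2) atTop (𝓝 (‖mFourierCoeff f k‖ₑ ^ 2)) :=
      ((ENNReal.continuous_pow 2).continuousAt.tendsto.comp (hcoef k).enorm)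
    by_cases hk : k = 0
    · subst hk; simp [hw]
    · exact ENNReal.Tendsto.const_mul h1 (Or.inr (by simp [hw, hk]))
  -- Fatou for the series (counting measure)
  have hsum : ∑' k, w k * ‖mFourierCoeff f k‖ₑ ^ 2 ≤ liminf (fun n => ∑' k, w k * ‖mFourierCoeff (F n) k‖ₑ ^ 2) atTop := by
    have hlim : ∀ k, w k * ‖mFourierCoeff f k‖ₑ ^ 2 = liminf (fun n => w k * ‖mFourierCoeff (F n) k‖ₑ ^ 2) atTop :=
      fun k => ((hterm k).liminf_eq).symm
    simp_rw [hlim]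
    have hF' := lintegral_liminf_le (μ := (Measure.count : Measure (d → ℤ))) (u := atTop) (f := fun (n : ℕ) k => w k * ‖mFourierCoeff (F n) k‖ₑ ^ 2)
      (fun n => measurable_of_countable _)
    simpa [lintegral_count] using hF'
  -- pass to the square root
  have hmono : Monotone fun x : ℝ≥0∞ => x ^ (1 / 2 : ℝ) := fun a b hab => ENNReal.rpow_le_rpow hab (by norm_num)
  have hcont : Continuous fun x : ℝ≥0∞ => x ^ (1 / 2 : ℝ) := ENNReal.continuous_rpow_const
  have hmap := hmono.map_liminf_of_continuousAt (F := atTop) (fun n => ∑' k, w k * ‖mFourierCoeff (F n) k‖ₑ ^ 2) hcont.continuousAt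
  calc (∑' k, w k * ‖mFourierCoeff f k‖ₑ ^ 2) ^ (1 / 2 : ℝ)
      ≤ (liminf (fun n => ∑' k, w k * ‖mFourierCoeff (F n) k‖ₑ ^ 2) atTop) ^ (1 / 2 : ℝ) := hmono hsum
    _ = liminf ((fun x : ℝ≥0∞ => x ^ (1 / 2 : ℝ)) ∘ fun n => ∑' k, w k * ‖mFourierCoeff (F n) k‖ₑ ^ 2) atTop := hmap
    _ = _ := rfl

end Torus

end Literature.Analysis.FunctionSpaces
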